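import Mathlib
import Summits.ValiantsHypothesis.ValiantsHypothesis.Theses.FeketeSOS

/-!
# `FeketeSOS.FeketeSOSHard` (stmt-ValiantsHypothesis-3996) — line `paley-rip`
# (crux-strategist, wall-breaker generation 1; archimedean / spectral place)

Every dead line of this crux and of its two children works at the place of `ℚ̄` ABOVE `p`
(Euler's criterion, `(X-1)`-adic depth, Witt carries).  This line works at the ARCHIMEDEAN place and
replaces "depth" by OPERATOR NORM.  Spine (all sums cyclic, i.e. modulo `X^p - 1`):

* `stub_paleyMassIdentity` (PROVABLE, M): for every cyclic representation
  `X^p - 1 ∣ Σ_i c_i g_i² − F_p` over `ℂ` with `deg g_i < p`,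
  `Σ_i c_i · Σ_{a,b ∈ supp g_i} χ_p(a+b) g_i(a) g_i(b) = p − 1`
  — pair the coefficient identity with `χ_p` itself (`Σ_{0<n<p} χ_p(n)² = p − 1`): the representation is ONE
  bilinear identity against the Paley–Hankel matrix `P = (χ_p(a+b))_{a,b}`.
* `stub_paleyFlatRIP` (the ENGINE; conjecture-class, in print): squares of sparse vectors do not
  correlate with `χ_p` — `|Σ_{a,b∈S} χ_p(a+b) w_a w_b| ≤ p^{1/2−κ} Σ_{a∈S}|w_a|²` for all `S ⊆ [0,p)` with
  `#S ≤ p^{1/2+δ₁}`, i.e. every principal `p^{1/2+δ₁}`-block of `P` has operator norm `≤ p^{1/2−κ}` (the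
  full matrix has all non-trivial singular values `= √p`: completion).  Under `b ↦ −b` this is the
  restricted-isometry property of the PALEY MATRIX beyond the square-root bottleneck,
  `PaleyRIP[1/2+δ₁, −κ]` of Bandeira–Mixon–Moreira (IMRN 2016, arXiv:1410.6457, Def. 2.1/Thm 2.3), which
  they derive from Chung's 1994 `PaleyDiscrepancy` conjecture (J. Number Theory 49, Conj. 2.2; proved
  there for exponent `> 1/2`) and which implies `PaleyClique[τ]` for some `τ < 1/2` (known: `1/2`,
  Hanson–Petridis).  Trivially true for `#S ≤ p^{1/2−κ}`; true for intervals by Burgess; the open range is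
  `p^{1/2−κ} < #S ≤ p^{1/2+δ₁}` = the Paley-graph-conjecture window.
* `stub_tameReduction` (OPEN; archimedean de-bordering = the mirror image of `SublinearShadow`): a
  cheap complex representation (`s ≤ p^δ` squares, support-sum `< p^{1/2+δ}`, `deg ≤ p²`) can be traded
  for a cyclic one whose squares have support `≤ p^{1/2+δ₁}` and whose ARCHIMEDEAN MASS
  `Σ_j |c'_j|·‖g'_j‖₂²` (the nuclear norm of the Gram matrix, by Takagi) is `≤ p^{1/2+η}` with `η < κ`.
  Folding alone gives the support condition (supports only shrink); the content is the mass bound —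
  wildly cancelling coefficients (`‖Gram‖_* ≫ √p` while its anti-diagonal sums are `±1`) must be
  dischargeable.  Tools that exist here and not at `p`: convexity (the mass-minimal Gram solution is an
  SDP with Hankel dual certificates), compactness/KKT at a mass-minimiser, low-rank-recovery theory for
  the anti-diagonal-sum operator (its rank-RIP fails exactly on additive quadruples `a+b=c+d` of the
  support — the additive-energy dichotomy of the support is the first cut).
* `stub_paleyCompletionBound` (PROVABLE, M; the unconditional half of the engine): `|Q_p(S,w)| ≤ √p · Σ_{a∈S}|w_a|²`
  for every `S ⊆ [0,p)` — Cauchy–Schwarz plus the Jacobsthal sums `Σ_x χ_p(x+b)χ_p(x+b') = −1` (b ≢ b'; landed as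
  `cs_sum_quadraticChar_mul_add` in Theorems/FeketeSOSCharPSparseSOSStubCharSum211.lean): `Σ_x |Σ_b χ(x+b)w_b|² = p‖w‖² − |Σ w_b|²`.
* `massFloor_of` : stubs 1 + 4 give the UNCONDITIONAL theorem "every cyclic SOS representation of `F_p` over `ℂ`
  (deg `< p`, any number of squares) has archimedean mass `Σ_i |c_i|·Σ_a|g_i(a)|² ≥ (p−1)/√p`" (sharp: the dense Gram
  solution `τ = P/p`); kernel-checked below modulo the two provable stubs — the line's guaranteed residue.
* `FeketeSOSHard_of` : the crux from stubs 1–3 (kernel-checked below): a cheap representation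
  would give `p − 1 = |Σ_j c'_j Q_j| ≤ p^{1/2−κ} · mass ≤ p^{1−(κ−η)} ≤ p/2`.

Disproof.lean (cdisprove cycle 1) honoured: `feketeSOSHard_false_without_legendre` — the all-ones pattern
`𝟙` is an EIGENVECTOR direction of nothing here: for `w ↦ Σ 𝟙(a+b) w_a w_b = (Σ w_a)²` the analogue of
`stub_paleyFlatRIP` is false (rank one, norm `#S`), and indeed `𝟙` is cheap; the line uses the VALUES of
`χ_p` through the flat spectrum of `P` (`P Pᵀ = pI − J`) and its conjectured restricted flatness.
`feketeSOSHard_false_without_prime` — at `N = q²` the Jacobi pattern vanishes on multiples of `q`, the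
matrix `(J(a+b | q²))` restricted to `S = [0,q) ∪ q[0,q)` contains the rank-one block `(J(k + qj)) = (J(k))_k ⊗ 𝟙_j`
of norm `≈ q = N^{1/2}`: flat-RIP fails for prime squares exactly where the cheap digit product lives.
No stub is an instance of a landed Negative lemma (`not_ordSparsitySum`, `ordSparsitySumWeak_false`,
`not_depthSpectrumGapWith_one/two` concern `(X−1)`-adic order in characteristic `p`; nothing here is
char-`p`).  `feketeSOSHard_false_of_cheapProducts`: a rank-`r` digit identity would violate
`stub_paleyFlatRIP` on `S = [0,a) ∪ a[0,b)` (tame, mass `≈ r√p`), consistent.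
-/

set_option linter.unusedVariables false
set_option linter.dupNamespace false

namespace Summit.ValiantsHypothesis.ValiantsHypothesis.Theorems.FeketeSOSHardPaleyRIP

open Polynomial Finset
open scoped BigOperators
open Summit.ValiantsHypothesis.ValiantsHypothesis.Theses

noncomputable section

/-- The Fekete polynomial over `ℂ` exactly as inlined in the crux: `Σ_{m<p} (m|p) X^m`. [folklore] -/
def fek (p : ℕ) [Fact p.Prime] : ℂ[X] :=
  ∑ m ∈ range p, C ((legendreSym p m : ℤ) : ℂ) * X ^ m

/-- The Paley–Hankel quadratic form of a coefficient vector `w` on a finite set `S ⊆ ℕ`: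
`Q_p(S, w) = Σ_{a,b ∈ S} χ_p(a+b) · w a · w b` (the Legendre symbol is `p`-periodic, so this is the
CYCLIC Paley–Hankel form). [folklore] -/
def paleyForm (p : ℕ) [Fact p.Prime] (S : Finset ℕ) (w : ℕ → ℂ) : ℂ :=
  ∑ a ∈ S, ∑ b ∈ S, ((legendreSym p ((a : ℤ) + b) : ℤ) : ℂ) * w a * w b

/-- The archimedean mass of one weighted square `c · g²`: `|c| · Σ_{a ∈ supp g} |g_a|²`. [folklore] -/
def sqMass (c : ℂ) (g : ℂ[X]) : ℝ :=
  ‖c‖ * ∑ a ∈ g.support, ‖g.coeff a‖ ^ 2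

/-! ## The registered stubs (1–3 compose to the crux; 1 + 4 give the unconditional mass floor) -/

/-- **Stub 1 — the Paley mass identity (provable).**  For a cyclic representation
`X^p − 1 ∣ Σ_i c_i g_i² − F_p` over `ℂ` with `deg g_i < p`, pairing the coefficient identity with `χ_p`
gives `Σ_i c_i · Q_p(supp g_i, coeff g_i) = p − 1`: the fold of `Σ c_i g_i²` has `n`-th coefficient
`χ_p(n)` for `n < p`, the fold of `g_i²` has `n`-th coefficient `Σ_{a+b ≡ n} g_i(a)g_i(b)`, and
`Σ_{n<p} χ_p(n)² = p − 1`. -/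
theorem stub_paleyMassIdentity :
    ∀ (p : ℕ) [Fact p.Prime] (s : ℕ) (c : Fin s → ℂ) (g : Fin s → ℂ[X]),
      (∀ i, (g i).natDegree < p) →
      ((X : ℂ[X]) ^ p - 1 ∣ (∑ i, C (c i) * g i ^ 2) - fek p) →
      (∑ i, c i * paleyForm p (g i).support (fun a => (g i).coeff a)) = (p : ℂ) - 1 := by
  sorry

/-- **Stub 2 — flat restricted isometry of the Paley–Hankel matrix beyond the square-root bottleneck
(the engine; conjecture-class).**  `∃ κ, δ₁ > 0`: for all large primes `p`, every `S ⊆ [0,p)` with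
`#S ≤ p^{1/2+δ₁}` and every `w`, `|Q_p(S,w)| ≤ p^{1/2−κ} Σ_{a∈S} |w a|²`.  Equivalent to: every principal
`p^{1/2+δ₁}`-block of `(χ_p(a+b))` has operator norm `≤ p^{1/2−κ}`; implied by `PaleyRIP[1/2+δ₁,−κ]`
(Bandeira–Mixon–Moreira 2016, Thm 2.3), hence by Chung's `PaleyDiscrepancy` conjecture; implies a
`p^{1/2−κ}` Paley sum-clique bound.  Trivial for `#S ≤ p^{1/2−κ}`; Burgess for intervals. -/
theorem stub_paleyFlatRIP :
    ∃ κ : ℝ, 0 < κ ∧ ∃ δ₁ : ℝ, 0 < δ₁ ∧ ∃ p₁ : ℕ, ∀ (p : ℕ) [Fact p.Prime], p₁ ≤ p →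
      ∀ (S : Finset ℕ), (∀ a ∈ S, a < p) → (S.card : ℝ) ≤ (p : ℝ) ^ (1 / 2 + δ₁) →
      ∀ (w : ℕ → ℂ), ‖paleyForm p S w‖ ≤ (p : ℝ) ^ (1 / 2 - κ) * ∑ a ∈ S, ‖w a‖ ^ 2 := by
  sorry

/-- **Stub 3 — tame reduction (archimedean de-bordering; open).**  For every `κ, δ₁ > 0` there are
`δ > 0` and `η < κ` such that, for all large primes `p`, a cheap complex representation of `F_p`
(`s ≤ p^δ` squares of degree `≤ p²`, support-sum `< p^{1/2+δ}`) yields a CYCLIC representation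
`X^p − 1 ∣ Σ_j c'_j g'_j² − F_p` with `deg g'_j < p`, every `#supp g'_j ≤ p^{1/2+δ₁}`, and total
archimedean mass `Σ_j |c'_j| Σ_a |g'_j(a)|² ≤ p^{1/2+η}` (any number of squares). -/
theorem stub_tameReduction :
    ∀ κ : ℝ, 0 < κ → ∀ δ₁ : ℝ, 0 < δ₁ → ∃ δ : ℝ, 0 < δ ∧ ∃ η : ℝ, η < κ ∧ ∃ p₂ : ℕ,
      ∀ (p : ℕ) [Fact p.Prime], p₂ ≤ p →
      ∀ (s : ℕ) (c : Fin s → ℂ) (g : Fin s → ℂ[X]), (s : ℝ) ≤ (p : ℝ) ^ δ →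
        (∀ i, (g i).natDegree ≤ p ^ 2) →
        (∑ i, C (c i) * g i ^ 2) = fek p →
        (∑ i, ((g i).support.card : ℝ)) < (p : ℝ) ^ (1 / 2 + δ) →
        ∃ (s' : ℕ) (c' : Fin s' → ℂ) (g' : Fin s' → ℂ[X]),
          (∀ j, (g' j).natDegree < p) ∧
          (∀ j, ((g' j).support.card : ℝ) ≤ (p : ℝ) ^ (1 / 2 + δ₁)) ∧
          ((X : ℂ[X]) ^ p - 1 ∣ (∑ j, C (c' j) * g' j ^ 2) - fek p) ∧
          (∑ j, sqMass (c' j) (g' j)) ≤ (p : ℝ) ^ (1 / 2 + η) := by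
  sorry

/-- **Stub 4 — the completion bound (provable; unconditional half of Stub 2).**  For every prime `p`, every
`S ⊆ [0,p)` and every `w`: `|Q_p(S,w)| ≤ √p · Σ_{a∈S} |w a|²`.  Proof: `|Σ_a w_a (Σ_b χ(a+b) w_b)| ≤ ‖w‖₂ (Σ_{a∈𝔽_p} |Σ_b χ(a+b)w_b|²)^{1/2}`
and the complete sum is `p‖w‖₂² − |Σ_b w_b|²` by the Jacobsthal sums `Σ_x χ(x+b)χ(x+b') = −1` (`b ≢ b'`), `= p − 1` (`b ≡ b'`). -/
theorem stub_paleyCompletionBound :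
    ∀ (p : ℕ) [Fact p.Prime] (S : Finset ℕ), (∀ a ∈ S, a < p) → ∀ (w : ℕ → ℂ),
      ‖paleyForm p S w‖ ≤ Real.sqrt p * ∑ a ∈ S, ‖w a‖ ^ 2 := by
  sorry

/-! ## Unconditional residue: the mass floor -/

/-- **Mass floor (from Stubs 1 and 4).**  Every cyclic representation `X^p − 1 ∣ Σ_i c_i g_i² − F_p` over `ℂ` with
`deg g_i < p` has archimedean mass `Σ_i |c_i| Σ_a |g_i(a)|² ≥ (p − 1)/√p`. -/
theorem massFloor_of (p : ℕ) [Fact p.Prime] (s : ℕ) (c : Fin s → ℂ) (g : Fin s → ℂ[X])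
    (hdeg : ∀ i, (g i).natDegree < p)
    (hdvd : (X : ℂ[X]) ^ p - 1 ∣ (∑ i, C (c i) * g i ^ 2) - fek p) :
    (p : ℝ) - 1 ≤ Real.sqrt p * ∑ i, sqMass (c i) (g i) := by
  classical
  have hprime : p.Prime := Fact.out
  have hid := stub_paleyMassIdentity p s c g hdeg hdvd
  have hnorm : ‖(p : ℂ) - 1‖ = (p : ℝ) - 1 := by
    have e : ((p : ℂ) - 1) = (((p : ℝ) - 1 : ℝ) : ℂ) := by push_cast; ring
    have h1 : (1 : ℝ) ≤ (p : ℝ) := by exact_mod_cast hprime.one_lt.le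
    rw [e, Complex.norm_real, Real.norm_eq_abs, abs_of_nonneg (by linarith)]
  have hQ : ∀ i, ‖paleyForm p (g i).support (fun a => (g i).coeff a)‖ ≤
      Real.sqrt p * ∑ a ∈ (g i).support, ‖(g i).coeff a‖ ^ 2 := fun i =>
    stub_paleyCompletionBound p (g i).support
      (fun a ha => lt_of_le_of_lt (le_natDegree_of_mem_supp a ha) (hdeg i)) (fun a => (g i).coeff a)
  rw [← hnorm, ← hid]
  calc ‖∑ i, c i * paleyForm p (g i).support (fun a => (g i).coeff a)‖
      ≤ ∑ i, ‖c i * paleyForm p (g i).support (fun a => (g i).coeff a)‖ := norm_sum_le _ _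
    _ = ∑ i, ‖c i‖ * ‖paleyForm p (g i).support (fun a => (g i).coeff a)‖ := by simp_rw [norm_mul]
    _ ≤ ∑ i, ‖c i‖ * (Real.sqrt p * ∑ a ∈ (g i).support, ‖(g i).coeff a‖ ^ 2) :=
        sum_le_sum fun i _ => mul_le_mul_of_nonneg_left (hQ i) (norm_nonneg _)
    _ = Real.sqrt p * ∑ i, sqMass (c i) (g i) := by
        rw [mul_sum]; refine sum_congr rfl fun i _ => ?_; unfold sqMass; ring

/-! ## Composition -/

/-- Threshold bookkeeping: if `2 ≤ p^θ` then `p^{1−θ} ≤ p/2`. -/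
theorem rpow_one_sub_le_half {p : ℕ} {θ : ℝ} (hp : 0 < p) (h2 : (2 : ℝ) ≤ (p : ℝ) ^ θ) :
    (p : ℝ) ^ (1 - θ) ≤ (p : ℝ) / 2 := by
  have hp0 : (0 : ℝ) < (p : ℝ) := by exact_mod_cast hp
  rw [Real.rpow_sub hp0, Real.rpow_one]
  have hθ0 : (0 : ℝ) < (p : ℝ) ^ θ := Real.rpow_pos_of_pos hp0 θ
  rw [div_le_div_iff_of_pos_left hp0 hθ0 (by norm_num : (0:ℝ) < 2)]
  exact h2

/-- **The crux from the line.**  `δ` and `η < κ` from the tame reduction applied to the flat-RIP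
exponents `κ, δ₁`; `p₀ = max(p₁, p₂, ⌈2^{1/(κ−η)}⌉, 3)`. -/
theorem FeketeSOSHard_of : FeketeSOS.FeketeSOSHard := by
  classical
  obtain ⟨κ, hκ, δ₁, hδ₁, p₁, hB⟩ := stub_paleyFlatRIP
  obtain ⟨δ, hδ, η, hηκ, p₂, hC⟩ := stub_tameReduction κ hκ δ₁ hδ₁
  set θ : ℝ := κ - η with hθ
  have hθpos : 0 < θ := by rw [hθ]; linarith
  obtain ⟨N, hN⟩ : ∃ N : ℕ, (2 : ℝ) ^ (1 / θ) ≤ (N : ℝ) := ⟨_, Nat.le_ceil _⟩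
  refine ⟨δ, hδ, max p₁ (max p₂ (max N 3)), ?_⟩
  intro p _ hp s c g hs hdeg hrep
  have hprime : p.Prime := Fact.out
  have hp₁ : p₁ ≤ p := le_trans (le_max_left _ _) hp
  have hp₂ : p₂ ≤ p := le_trans (le_trans (le_max_left _ _) (le_max_right _ _)) hp
  have hpN : N ≤ p := le_trans (le_trans (le_trans (le_max_left _ _) (le_max_right _ _)) (le_max_right _ _)) hp
  have hp3 : 3 ≤ p := le_trans (le_trans (le_trans (le_max_right _ _) (le_max_right _ _)) (le_max_right _ _)) hp
  have hp1 : (1 : ℝ) ≤ (p : ℝ) := by exact_mod_cast hprime.one_lt.le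
  have hp0 : (0 : ℝ) < (p : ℝ) := by linarith
  -- the representation in the line's vocabulary
  have hrep' : (∑ i, C (c i) * g i ^ 2) = fek p := by rw [hrep]; rfl
  by_contra hlt
  push Not at hlt
  -- Step 1: tame cyclic representation
  obtain ⟨s', c', g', hdeg', hsupp', hdvd', hmass⟩ := hC p hp₂ s c g hs hdeg hrep' hlt
  -- Step 2: the Paley mass identity
  have hid := stub_paleyMassIdentity p s' c' g' hdeg' hdvd'
  -- Step 3: flat-RIP on each square
  have hQ : ∀ j, ‖paleyForm p (g' j).support (fun a => (g' j).coeff a)‖ ≤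
      (p : ℝ) ^ (1 / 2 - κ) * ∑ a ∈ (g' j).support, ‖(g' j).coeff a‖ ^ 2 := by
    intro j
    refine hB p hp₁ (g' j).support (fun a ha => ?_) (hsupp' j) (fun a => (g' j).coeff a)
    exact lt_of_le_of_lt (le_natDegree_of_mem_supp a ha) (hdeg' j)
  -- Step 4: norms
  have hnorm : ‖(p : ℂ) - 1‖ = (p : ℝ) - 1 := by
    have e : ((p : ℂ) - 1) = (((p : ℝ) - 1 : ℝ) : ℂ) := by push_cast; ring
    rw [e, Complex.norm_real, Real.norm_eq_abs, abs_of_nonneg (by linarith)]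
  have hbound : (p : ℝ) - 1 ≤ (p : ℝ) ^ (1 / 2 - κ) * (p : ℝ) ^ (1 / 2 + η) := by
    rw [← hnorm, ← hid]
    calc ‖∑ j, c' j * paleyForm p (g' j).support (fun a => (g' j).coeff a)‖
        ≤ ∑ j, ‖c' j * paleyForm p (g' j).support (fun a => (g' j).coeff a)‖ := norm_sum_le _ _
      _ = ∑ j, ‖c' j‖ * ‖paleyForm p (g' j).support (fun a => (g' j).coeff a)‖ := by
          simp_rw [norm_mul]
      _ ≤ ∑ j, ‖c' j‖ * ((p : ℝ) ^ (1 / 2 - κ) * ∑ a ∈ (g' j).support, ‖(g' j).coeff a‖ ^ 2) :=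
          sum_le_sum fun j _ => mul_le_mul_of_nonneg_left (hQ j) (norm_nonneg _)
      _ = (p : ℝ) ^ (1 / 2 - κ) * ∑ j, sqMass (c' j) (g' j) := by
          rw [mul_sum]; refine sum_congr rfl fun j _ => ?_; unfold sqMass; ring
      _ ≤ (p : ℝ) ^ (1 / 2 - κ) * (p : ℝ) ^ (1 / 2 + η) :=
          mul_le_mul_of_nonneg_left hmass (Real.rpow_nonneg hp0.le _)
  -- Step 5: exponent bookkeeping, p^{1/2-κ} p^{1/2+η} = p^{1-θ} ≤ p/2 < p - 1
  have hexp : (p : ℝ) ^ (1 / 2 - κ) * (p : ℝ) ^ (1 / 2 + η) = (p : ℝ) ^ (1 - θ) := by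
    rw [← Real.rpow_add hp0]; congr 1; rw [hθ]; ring
  have h2 : (2 : ℝ) ≤ (p : ℝ) ^ θ := by
    have hbase : (2 : ℝ) ^ (1 / θ) ≤ (p : ℝ) := hN.trans (by exact_mod_cast hpN)
    have h20 : (0 : ℝ) ≤ (2 : ℝ) ^ (1 / θ) := Real.rpow_nonneg (by norm_num) _
    have hmono : ((2 : ℝ) ^ (1 / θ)) ^ θ ≤ (p : ℝ) ^ θ := Real.rpow_le_rpow h20 hbase hθpos.le
    have hid2 : ((2 : ℝ) ^ (1 / θ)) ^ θ = 2 := by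
      rw [← Real.rpow_mul (by norm_num : (0:ℝ) ≤ 2)]
      have : (1 / θ) * θ = 1 := by field_simp
      rw [this, Real.rpow_one]
    rw [hid2] at hmono
    exact hmono
  have hhalf : (p : ℝ) ^ (1 - θ) ≤ (p : ℝ) / 2 := rpow_one_sub_le_half hprime.pos h2
  have hp3r : (3 : ℝ) ≤ (p : ℝ) := by exact_mod_cast hp3
  have : (p : ℝ) - 1 ≤ (p : ℝ) / 2 := by rw [hexp] at hbound; exact hbound.trans hhalf
  linarith

/-- The crux, by its conventional closing name. -/
theorem FeketeSOSHard_proof : FeketeSOS.FeketeSOSHard := FeketeSOSHard_of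

end

end Summit.ValiantsHypothesis.ValiantsHypothesis.Theorems.FeketeSOSHardPaleyRIP
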